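import Summits.Parity.GeneralizedHardyLittlewood.Theorems.PrimeLevelFamEdgeMomentsBeyondDiagonalLayersWeightTailTerm
import HarnessLib

/-!
# Route `PrimeLevelFamEdge`, crux K_A `MomentsBeyondDiagonal` (stmt-Parity-20007), line «petersson_layers» v4:
# the AFE-WEIGHT TAIL of an order-`(i, j)` divisor-first layer sum, II: THE SUMMED TAIL and THE SPLIT (step A1 of `stub_farP`)

Sequel of `…LayersWeightTailTerm` (one term of `I_{ij}(r)` with `d₁n₁'·d₂n₂' > Y` is `≤ E (d₁d₂)^{−2} n₁'^{−2} n₂'^{−2}`,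
`E = 4π² K_A L B² (q̂²/Y)^{A−2} q̂⁴/(qr)`):
* `sum_six_inv_sq_le`: the bookkeeping sum `Σ E (d₁d₂)^{−2} n₁^{−2} n₂^{−2} ≤ 16 M₀² E` (`Σ 1/n² ≤ 2`, `#[1, M₀/d] ≤ M₀`);
* **`norm_orderTail_le`**: for every real `P`, orders `(i,j)`, `A ≥ 2` there is `C ≥ 0` with
  `‖I_{ij}(r) restricted to d₁n₁'d₂n₂' > Y‖ ≤ C ((1+log q̂)(1+2log q))^{i+j} M² q̂⁴ (q̂²/Y)^{A−2}/(qr)` (`q ≥ 64`, `Δ' > 0`,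
  `r, Y ≥ 1`) — with `Y ≥ q̂^{2+η}` this is `≪ M² q̂^{4−η(A−2)}/(qr)`, negligible for `A` large (the assembly's choice);
* `orderSum_eq_main_add_tail`: `I_{ij}(r) = [d₁n₁'d₂n₂' ≤ Y part] + [d₁n₁'d₂n₂' > Y part]` (innermost range filtered).
So after `…LayersLayerFromOrderBound` the print band of `stub_farP` is a statement about the EFFECTIVE-BOX sums
`d₁n₁'·d₂n₂' ≤ Y ≈ q̂^{2+η}` only. Proof only (def-free helper); K_A NOT proved; nothing about Landau–Siegel zeros.
-/

noncomputable section

open scoped Real Nat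
open Complex Finset Polynomial MeasureTheory
open Literature.NumberTheory.LFunctions

namespace Summit.Parity.GeneralizedHardyLittlewood.Theorems.MomentsBeyondDiagonal.Layers

open Summit.Parity.GeneralizedHardyLittlewood.Theorems.PrimeLevelFamEdgeIdeaDeltas.PeterssonLayers

/-! ## §5. The tail of `I_{ij}(r)` -/

/-- The pure bookkeeping sum: `Σ_{d₁,d₂ ≤ M₀} Σ_{m₁ ≤ M₀/d₁, n₁ ≤ X₀/d₁, m₂ ≤ M₀/d₂, n₂ ≤ X₀/d₂} E (d₁d₂)^{−2} n₁^{−2} n₂^{−2}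
≤ 16 M₀² E` (`Σ 1/n² ≤ 2`, `#[1, M₀/d] ≤ M₀`). [folklore] -/
theorem sum_six_inv_sq_le (M₀ X₀ : ℕ) {E : ℝ} (hE : 0 ≤ E) :
    ∑ d₁ ∈ Icc 1 M₀, ∑ d₂ ∈ Icc 1 M₀, ∑ _m₁ ∈ Icc 1 (M₀ / d₁), ∑ n₁ ∈ Icc 1 (X₀ / d₁),
      ∑ _m₂ ∈ Icc 1 (M₀ / d₂), ∑ n₂ ∈ Icc 1 (X₀ / d₂),
        E * (((((d₁ : ℝ) * d₂) ^ 2)⁻¹) * (((n₁ : ℝ) ^ 2)⁻¹) * (((n₂ : ℝ) ^ 2)⁻¹)) ≤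
      16 * (M₀ : ℝ) ^ 2 * E := by
  have hcard : ∀ d : ℕ, (#(Icc 1 (M₀ / d)) : ℝ) ≤ M₀ := by
    intro d
    rw [Nat.card_Icc]
    have : M₀ / d + 1 - 1 ≤ M₀ := by simpa using Nat.div_le_self M₀ d
    exact_mod_cast this
  have hM₀ : (0 : ℝ) ≤ M₀ := Nat.cast_nonneg _
  -- innermost: the `n₂`-sum
  have h6 : ∀ d₁ d₂ n₁ : ℕ,
      ∑ n₂ ∈ Icc 1 (X₀ / d₂), E * (((((d₁ : ℝ) * d₂) ^ 2)⁻¹) * (((n₁ : ℝ) ^ 2)⁻¹) * (((n₂ : ℝ) ^ 2)⁻¹)) ≤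
        E * ((((d₁ : ℝ) * d₂) ^ 2)⁻¹) * (((n₁ : ℝ) ^ 2)⁻¹) * 2 := by
    intro d₁ d₂ n₁
    have e : ∀ n₂ : ℕ, E * (((((d₁ : ℝ) * d₂) ^ 2)⁻¹) * (((n₁ : ℝ) ^ 2)⁻¹) * (((n₂ : ℝ) ^ 2)⁻¹)) =
        (E * ((((d₁ : ℝ) * d₂) ^ 2)⁻¹) * (((n₁ : ℝ) ^ 2)⁻¹)) * (((n₂ : ℝ) ^ 2)⁻¹) := fun n₂ ↦ by ring
    simp_rw [e]
    rw [← mul_sum]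
    exact mul_le_mul_of_nonneg_left (sum_Icc_inv_sq_le_two _) (by positivity)
  -- the `m₂`-sum (constant)
  have h5 : ∀ d₁ d₂ n₁ : ℕ,
      ∑ _m₂ ∈ Icc 1 (M₀ / d₂), ∑ n₂ ∈ Icc 1 (X₀ / d₂),
          E * (((((d₁ : ℝ) * d₂) ^ 2)⁻¹) * (((n₁ : ℝ) ^ 2)⁻¹) * (((n₂ : ℝ) ^ 2)⁻¹)) ≤
        (M₀ : ℝ) * (E * ((((d₁ : ℝ) * d₂) ^ 2)⁻¹) * (((n₁ : ℝ) ^ 2)⁻¹) * 2) := by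
    intro d₁ d₂ n₁
    calc _ ≤ ∑ _m₂ ∈ Icc 1 (M₀ / d₂), E * ((((d₁ : ℝ) * d₂) ^ 2)⁻¹) * (((n₁ : ℝ) ^ 2)⁻¹) * 2 :=
          sum_le_sum fun _ _ ↦ h6 d₁ d₂ n₁
      _ = (#(Icc 1 (M₀ / d₂)) : ℝ) * (E * ((((d₁ : ℝ) * d₂) ^ 2)⁻¹) * (((n₁ : ℝ) ^ 2)⁻¹) * 2) := by
          rw [sum_const, nsmul_eq_mul]
      _ ≤ (M₀ : ℝ) * (E * ((((d₁ : ℝ) * d₂) ^ 2)⁻¹) * (((n₁ : ℝ) ^ 2)⁻¹) * 2) :=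
          mul_le_mul_of_nonneg_right (hcard d₂) (by positivity)
  -- the `n₁`-sum
  have h4 : ∀ d₁ d₂ : ℕ,
      ∑ n₁ ∈ Icc 1 (X₀ / d₁), ∑ _m₂ ∈ Icc 1 (M₀ / d₂), ∑ n₂ ∈ Icc 1 (X₀ / d₂),
          E * (((((d₁ : ℝ) * d₂) ^ 2)⁻¹) * (((n₁ : ℝ) ^ 2)⁻¹) * (((n₂ : ℝ) ^ 2)⁻¹)) ≤
        (M₀ : ℝ) * E * ((((d₁ : ℝ) * d₂) ^ 2)⁻¹) * 4 := by
    intro d₁ d₂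
    calc _ ≤ ∑ n₁ ∈ Icc 1 (X₀ / d₁), (M₀ : ℝ) * (E * ((((d₁ : ℝ) * d₂) ^ 2)⁻¹) * (((n₁ : ℝ) ^ 2)⁻¹) * 2) :=
          sum_le_sum fun n₁ _ ↦ h5 d₁ d₂ n₁
      _ = ((M₀ : ℝ) * E * ((((d₁ : ℝ) * d₂) ^ 2)⁻¹) * 2) * ∑ n₁ ∈ Icc 1 (X₀ / d₁), (((n₁ : ℝ) ^ 2)⁻¹) := by
          rw [mul_sum]
          refine sum_congr rfl fun n₁ _ ↦ ?_
          ring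
      _ ≤ ((M₀ : ℝ) * E * ((((d₁ : ℝ) * d₂) ^ 2)⁻¹) * 2) * 2 :=
          mul_le_mul_of_nonneg_left (sum_Icc_inv_sq_le_two _) (by positivity)
      _ = (M₀ : ℝ) * E * ((((d₁ : ℝ) * d₂) ^ 2)⁻¹) * 4 := by ring
  -- the `m₁`-sum (constant)
  have h3 : ∀ d₁ d₂ : ℕ,
      ∑ _m₁ ∈ Icc 1 (M₀ / d₁), ∑ n₁ ∈ Icc 1 (X₀ / d₁), ∑ _m₂ ∈ Icc 1 (M₀ / d₂), ∑ n₂ ∈ Icc 1 (X₀ / d₂),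
          E * (((((d₁ : ℝ) * d₂) ^ 2)⁻¹) * (((n₁ : ℝ) ^ 2)⁻¹) * (((n₂ : ℝ) ^ 2)⁻¹)) ≤
        (M₀ : ℝ) ^ 2 * E * 4 * (((((d₁ : ℝ)) ^ 2)⁻¹) * ((((d₂ : ℝ)) ^ 2)⁻¹)) := by
    intro d₁ d₂
    calc _ ≤ ∑ _m₁ ∈ Icc 1 (M₀ / d₁), (M₀ : ℝ) * E * ((((d₁ : ℝ) * d₂) ^ 2)⁻¹) * 4 :=
          sum_le_sum fun _ _ ↦ h4 d₁ d₂
      _ = (#(Icc 1 (M₀ / d₁)) : ℝ) * ((M₀ : ℝ) * E * ((((d₁ : ℝ) * d₂) ^ 2)⁻¹) * 4) := by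
          rw [sum_const, nsmul_eq_mul]
      _ ≤ (M₀ : ℝ) * ((M₀ : ℝ) * E * ((((d₁ : ℝ) * d₂) ^ 2)⁻¹) * 4) :=
          mul_le_mul_of_nonneg_right (hcard d₁) (by positivity)
      _ = (M₀ : ℝ) ^ 2 * E * 4 * (((((d₁ : ℝ)) ^ 2)⁻¹) * ((((d₂ : ℝ)) ^ 2)⁻¹)) := by
          rw [mul_pow, mul_inv]
          ring
  -- the `d₂`-sum
  have h2 : ∀ d₁ : ℕ,
      ∑ d₂ ∈ Icc 1 M₀, ∑ _m₁ ∈ Icc 1 (M₀ / d₁), ∑ n₁ ∈ Icc 1 (X₀ / d₁), ∑ _m₂ ∈ Icc 1 (M₀ / d₂),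
          ∑ n₂ ∈ Icc 1 (X₀ / d₂), E * (((((d₁ : ℝ) * d₂) ^ 2)⁻¹) * (((n₁ : ℝ) ^ 2)⁻¹) * (((n₂ : ℝ) ^ 2)⁻¹)) ≤
        (M₀ : ℝ) ^ 2 * E * 8 * ((((d₁ : ℝ)) ^ 2)⁻¹) := by
    intro d₁
    calc _ ≤ ∑ d₂ ∈ Icc 1 M₀, (M₀ : ℝ) ^ 2 * E * 4 * (((((d₁ : ℝ)) ^ 2)⁻¹) * ((((d₂ : ℝ)) ^ 2)⁻¹)) :=
          sum_le_sum fun d₂ _ ↦ h3 d₁ d₂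
      _ = ((M₀ : ℝ) ^ 2 * E * 4 * ((((d₁ : ℝ)) ^ 2)⁻¹)) * ∑ d₂ ∈ Icc 1 M₀, ((((d₂ : ℝ)) ^ 2)⁻¹) := by
          rw [mul_sum]
          refine sum_congr rfl fun d₂ _ ↦ ?_
          ring
      _ ≤ ((M₀ : ℝ) ^ 2 * E * 4 * ((((d₁ : ℝ)) ^ 2)⁻¹)) * 2 :=
          mul_le_mul_of_nonneg_left (sum_Icc_inv_sq_le_two _) (by positivity)
      _ = (M₀ : ℝ) ^ 2 * E * 8 * ((((d₁ : ℝ)) ^ 2)⁻¹) := by ring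
  -- the `d₁`-sum
  calc _ ≤ ∑ d₁ ∈ Icc 1 M₀, (M₀ : ℝ) ^ 2 * E * 8 * ((((d₁ : ℝ)) ^ 2)⁻¹) := sum_le_sum fun d₁ _ ↦ h2 d₁
    _ = ((M₀ : ℝ) ^ 2 * E * 8) * ∑ d₁ ∈ Icc 1 M₀, ((((d₁ : ℝ)) ^ 2)⁻¹) := by rw [mul_sum]
    _ ≤ ((M₀ : ℝ) ^ 2 * E * 8) * 2 := mul_le_mul_of_nonneg_left (sum_Icc_inv_sq_le_two _) (by positivity)
    _ = 16 * (M₀ : ℝ) ^ 2 * E := by ring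

/-- **THE AFE-WEIGHT TAIL OF `I_{ij}(r)`.** For every real `P`, orders `(i,j)` and decay exponent `A ≥ 2` there is
`C ≥ 0` such that for `q ≥ 64`, `Δ' > 0` (`M = q̂^{Δ'}`), `r ≥ 1` and every threshold `Y ≥ 1`, the part of the order-`(i,j)`
divisor-first layer sum with `d₁n₁'·d₂n₂' > Y` satisfies
`‖Σ_{d₁n₁'d₂n₂' > Y} …‖ ≤ C · ((1+log q̂)(1+2log q))^{i+j} · M² · q̂⁴ · (q̂²/Y)^{A−2} / (qr)`
(trivial bounds `|S| ≤ qr`, `|J₁(x)| ≤ x/2`, `|x_m| ≤ B m^{−1/2}`, and `‖W_{ij}‖ ≪_A (q̂²/(n₁n₂))^A`). With `Y ≥ q̂^{2+η}`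
this is `≪ M² q̂^{4 − η(A−2)}/(qr)`, negligible for `A` large. [cite: KowalskiMichelVanderKam2000, (22) p. 12 («decays
faster than any negative power of y»)] -/
theorem norm_orderTail_le (P : ℝ[X]) (i j : ℕ) {A : ℝ} (hA : 2 ≤ A) :
    ∃ C : ℝ, 0 ≤ C ∧ ∀ (q : ℕ) [NeZero q], 64 ≤ q → ∀ Δ' : ℝ, 0 < Δ' → ∀ r : ℕ, r ≠ 0 → ∀ Y : ℕ, 1 ≤ Y →
      ‖∑ d₁ ∈ Icc 1 ⌊KMV2000.qhat q ^ Δ'⌋₊, ∑ d₂ ∈ Icc 1 ⌊KMV2000.qhat q ^ Δ'⌋₊,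
          ∑ m₁ ∈ Icc 1 (⌊KMV2000.qhat q ^ Δ'⌋₊ / d₁), ∑ n₁ ∈ Icc 1 (q ^ 2 / d₁),
          ∑ m₂ ∈ Icc 1 (⌊KMV2000.qhat q ^ Δ'⌋₊ / d₂),
          ∑ n₂ ∈ (Icc 1 (q ^ 2 / d₂)).filter (fun n₂ ↦ Y < d₁ * n₁ * (d₂ * n₂)),
            ((((((d₁ * n₁ : ℕ) : ℝ) * ((d₂ * n₂ : ℕ) : ℝ)) ^ (-(1 / 2 : ℝ)) : ℝ) : ℂ) *
                afeW (KMV2000.qhat q) i j (d₁ * n₁) (d₂ * n₂)) *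
              ((KMV2000.mollifierCoeff P (KMV2000.qhat q ^ Δ') (d₁ * m₁) : ℂ) *
                (KMV2000.mollifierCoeff P (KMV2000.qhat q ^ Δ') (d₂ * m₂) : ℂ) *
                layerKernel q r (m₁ * n₁) (m₂ * n₂))‖ ≤
        C * ((1 + Real.log (KMV2000.qhat q)) * (1 + 2 * Real.log q)) ^ (i + j) * (KMV2000.qhat q ^ Δ') ^ 2 *
          KMV2000.qhat q ^ 4 * (KMV2000.qhat q ^ 2 / (Y : ℝ)) ^ (A - 2) / ((q : ℝ) * r) := by
  obtain ⟨K, hK0, hK⟩ := weight_mul_sqrt_le_rpow i j (by linarith : (0 : ℝ) ≤ A)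
  set B : ℝ := ∑ i ∈ range (P.natDegree + 1), |P.coeff i| with hBdef
  have hB : ∀ t ∈ Set.Icc (0 : ℝ) 1, |P.eval t| ≤ B := fun t ht ↦ abs_eval_le_sum_abs_coeff P ht
  have hB0 : 0 ≤ B := le_trans (abs_nonneg _) (hB 0 (by simp))
  refine ⟨16 * (4 * π ^ 2 * K * B ^ 2), by positivity, fun q _ h64 Δ' hΔ' r hr Y hY ↦ ?_⟩
  have hqh1 : 1 < KMV2000.qhat q := one_lt_qhat h64
  have hqh0 : 0 < KMV2000.qhat q := zero_lt_one.trans hqh1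
  have hq0 : (0 : ℝ) < q := by exact_mod_cast Nat.pos_of_ne_zero (NeZero.ne q)
  have hr0 : (0 : ℝ) < r := by exact_mod_cast Nat.pos_of_ne_zero hr
  set L : ℝ := ((1 + Real.log (KMV2000.qhat q)) * (1 + 2 * Real.log q)) ^ (i + j) with hL
  have hL0 : 0 ≤ L := by
    rw [hL]
    refine pow_nonneg (mul_nonneg ?_ ?_) _
    · linarith [Real.log_nonneg hqh1.le]
    · have : (1 : ℝ) ≤ q := by exact_mod_cast (le_trans (by norm_num) h64 : 1 ≤ q)
      linarith [Real.log_nonneg this]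
  set Mf : ℕ := ⌊KMV2000.qhat q ^ Δ'⌋₊ with hMf
  have hMfle : (Mf : ℝ) ≤ KMV2000.qhat q ^ Δ' := Nat.floor_le (Real.rpow_nonneg hqh0.le _)
  set E : ℝ := 4 * π ^ 2 * K * L * B ^ 2 * (KMV2000.qhat q ^ 2 / (Y : ℝ)) ^ (A - 2) * KMV2000.qhat q ^ 4 /
    ((q : ℝ) * r) with hE
  have hdec0 : 0 ≤ (KMV2000.qhat q ^ 2 / (Y : ℝ)) ^ (A - 2) := Real.rpow_nonneg (by positivity) _
  have hE0 : 0 ≤ E := by rw [hE]; positivity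
  -- termwise, then drop the filter, then the bookkeeping sum
  have hmain : ‖∑ d₁ ∈ Icc 1 Mf, ∑ d₂ ∈ Icc 1 Mf, ∑ m₁ ∈ Icc 1 (Mf / d₁), ∑ n₁ ∈ Icc 1 (q ^ 2 / d₁),
      ∑ m₂ ∈ Icc 1 (Mf / d₂), ∑ n₂ ∈ (Icc 1 (q ^ 2 / d₂)).filter (fun n₂ ↦ Y < d₁ * n₁ * (d₂ * n₂)),
        ((((((d₁ * n₁ : ℕ) : ℝ) * ((d₂ * n₂ : ℕ) : ℝ)) ^ (-(1 / 2 : ℝ)) : ℝ) : ℂ) *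
            afeW (KMV2000.qhat q) i j (d₁ * n₁) (d₂ * n₂)) *
          ((KMV2000.mollifierCoeff P (KMV2000.qhat q ^ Δ') (d₁ * m₁) : ℂ) *
            (KMV2000.mollifierCoeff P (KMV2000.qhat q ^ Δ') (d₂ * m₂) : ℂ) *
            layerKernel q r (m₁ * n₁) (m₂ * n₂))‖ ≤
      ∑ d₁ ∈ Icc 1 Mf, ∑ d₂ ∈ Icc 1 Mf, ∑ _m₁ ∈ Icc 1 (Mf / d₁), ∑ n₁ ∈ Icc 1 (q ^ 2 / d₁),
        ∑ _m₂ ∈ Icc 1 (Mf / d₂), ∑ n₂ ∈ Icc 1 (q ^ 2 / d₂),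
          E * (((((d₁ : ℝ) * d₂) ^ 2)⁻¹) * (((n₁ : ℝ) ^ 2)⁻¹) * (((n₂ : ℝ) ^ 2)⁻¹)) := by
    refine (norm_sum_le _ _).trans (sum_le_sum fun d₁ hd₁ ↦ ?_)
    refine (norm_sum_le _ _).trans (sum_le_sum fun d₂ hd₂ ↦ ?_)
    refine (norm_sum_le _ _).trans (sum_le_sum fun m₁ hm₁ ↦ ?_)
    refine (norm_sum_le _ _).trans (sum_le_sum fun n₁ hn₁ ↦ ?_)
    refine (norm_sum_le _ _).trans (sum_le_sum fun m₂ hm₂ ↦ ?_)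
    refine (norm_sum_le _ _).trans ?_
    refine (sum_le_sum fun n₂ hn₂ ↦ ?_).trans
      (sum_le_sum_of_subset_of_nonneg (filter_subset _ _) fun n₂ _ _ ↦ by positivity)
    have hn₂' := (mem_filter.mp hn₂)
    have h := norm_orderTerm_le_of_lt h64 hB hΔ' i j hA hK0 (fun hN₁ hN₂ ↦ hK h64 hN₁ hN₂) hr hY
      hd₁ hd₂ hm₁ hn₁ hm₂ hn₂'.1 hn₂'.2
    rw [hE]
    exact h
  refine hmain.trans ((sum_six_inv_sq_le Mf (q ^ 2) hE0).trans ?_)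
  -- `16 Mf² E ≤ C L M² q̂⁴ (q̂²/Y)^{A-2}/(qr)`
  rw [hE]
  have hMf2 : (Mf : ℝ) ^ 2 ≤ (KMV2000.qhat q ^ Δ') ^ 2 := pow_le_pow_left₀ (Nat.cast_nonneg _) hMfle 2
  have hrest : 0 ≤ 4 * π ^ 2 * K * L * B ^ 2 * (KMV2000.qhat q ^ 2 / (Y : ℝ)) ^ (A - 2) * KMV2000.qhat q ^ 4 /
      ((q : ℝ) * r) := hE0
  calc 16 * (Mf : ℝ) ^ 2 * (4 * π ^ 2 * K * L * B ^ 2 * (KMV2000.qhat q ^ 2 / (Y : ℝ)) ^ (A - 2) *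
        KMV2000.qhat q ^ 4 / ((q : ℝ) * r))
      ≤ 16 * (KMV2000.qhat q ^ Δ') ^ 2 * (4 * π ^ 2 * K * L * B ^ 2 * (KMV2000.qhat q ^ 2 / (Y : ℝ)) ^ (A - 2) *
        KMV2000.qhat q ^ 4 / ((q : ℝ) * r)) := by gcongr
    _ = _ := by rw [hL]; ring

/-! ## §6. The split of `I_{ij}(r)` at the threshold `Y` -/

/-- **`I_{ij}(r) = (part with d₁n₁'d₂n₂' ≤ Y) + (part with d₁n₁'d₂n₂' > Y)`** (the innermost `n₂'`-range filtered).
[folklore] -/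
theorem orderSum_eq_main_add_tail (q : ℕ) [NeZero q] (P : ℝ[X]) (Δ' : ℝ) (i j r Y : ℕ) :
    ∑ d₁ ∈ Icc 1 ⌊KMV2000.qhat q ^ Δ'⌋₊, ∑ d₂ ∈ Icc 1 ⌊KMV2000.qhat q ^ Δ'⌋₊,
        ∑ m₁ ∈ Icc 1 (⌊KMV2000.qhat q ^ Δ'⌋₊ / d₁), ∑ n₁ ∈ Icc 1 (q ^ 2 / d₁),
        ∑ m₂ ∈ Icc 1 (⌊KMV2000.qhat q ^ Δ'⌋₊ / d₂), ∑ n₂ ∈ Icc 1 (q ^ 2 / d₂),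
          ((((((d₁ * n₁ : ℕ) : ℝ) * ((d₂ * n₂ : ℕ) : ℝ)) ^ (-(1 / 2 : ℝ)) : ℝ) : ℂ) *
              afeW (KMV2000.qhat q) i j (d₁ * n₁) (d₂ * n₂)) *
            ((KMV2000.mollifierCoeff P (KMV2000.qhat q ^ Δ') (d₁ * m₁) : ℂ) *
              (KMV2000.mollifierCoeff P (KMV2000.qhat q ^ Δ') (d₂ * m₂) : ℂ) *
              layerKernel q r (m₁ * n₁) (m₂ * n₂)) =
      ∑ d₁ ∈ Icc 1 ⌊KMV2000.qhat q ^ Δ'⌋₊, ∑ d₂ ∈ Icc 1 ⌊KMV2000.qhat q ^ Δ'⌋₊,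
        ∑ m₁ ∈ Icc 1 (⌊KMV2000.qhat q ^ Δ'⌋₊ / d₁), ∑ n₁ ∈ Icc 1 (q ^ 2 / d₁),
        ∑ m₂ ∈ Icc 1 (⌊KMV2000.qhat q ^ Δ'⌋₊ / d₂),
        ∑ n₂ ∈ (Icc 1 (q ^ 2 / d₂)).filter (fun n₂ ↦ d₁ * n₁ * (d₂ * n₂) ≤ Y),
          ((((((d₁ * n₁ : ℕ) : ℝ) * ((d₂ * n₂ : ℕ) : ℝ)) ^ (-(1 / 2 : ℝ)) : ℝ) : ℂ) *
              afeW (KMV2000.qhat q) i j (d₁ * n₁) (d₂ * n₂)) *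
            ((KMV2000.mollifierCoeff P (KMV2000.qhat q ^ Δ') (d₁ * m₁) : ℂ) *
              (KMV2000.mollifierCoeff P (KMV2000.qhat q ^ Δ') (d₂ * m₂) : ℂ) *
              layerKernel q r (m₁ * n₁) (m₂ * n₂)) +
      ∑ d₁ ∈ Icc 1 ⌊KMV2000.qhat q ^ Δ'⌋₊, ∑ d₂ ∈ Icc 1 ⌊KMV2000.qhat q ^ Δ'⌋₊,
        ∑ m₁ ∈ Icc 1 (⌊KMV2000.qhat q ^ Δ'⌋₊ / d₁), ∑ n₁ ∈ Icc 1 (q ^ 2 / d₁),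
        ∑ m₂ ∈ Icc 1 (⌊KMV2000.qhat q ^ Δ'⌋₊ / d₂),
        ∑ n₂ ∈ (Icc 1 (q ^ 2 / d₂)).filter (fun n₂ ↦ Y < d₁ * n₁ * (d₂ * n₂)),
          ((((((d₁ * n₁ : ℕ) : ℝ) * ((d₂ * n₂ : ℕ) : ℝ)) ^ (-(1 / 2 : ℝ)) : ℝ) : ℂ) *
              afeW (KMV2000.qhat q) i j (d₁ * n₁) (d₂ * n₂)) *
            ((KMV2000.mollifierCoeff P (KMV2000.qhat q ^ Δ') (d₁ * m₁) : ℂ) *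
              (KMV2000.mollifierCoeff P (KMV2000.qhat q ^ Δ') (d₂ * m₂) : ℂ) *
              layerKernel q r (m₁ * n₁) (m₂ * n₂)) := by
  simp only [← sum_add_distrib]
  refine sum_congr rfl fun d₁ _ ↦ sum_congr rfl fun d₂ _ ↦ sum_congr rfl fun m₁ _ ↦ sum_congr rfl fun n₁ _ ↦
    sum_congr rfl fun m₂ _ ↦ ?_
  rw [← sum_filter_add_sum_filter_not (Icc 1 (q ^ 2 / d₂)) (fun n₂ ↦ d₁ * n₁ * (d₂ * n₂) ≤ Y)]
  congr 1
  refine sum_congr ?_ fun _ _ ↦ rfl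
  ext n₂
  simp only [mem_filter, not_le]

end Summit.Parity.GeneralizedHardyLittlewood.Theorems.MomentsBeyondDiagonal.Layers

end
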